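import Summits.ResolutionOfSingularities.ResolutionOfSingularities.Theorems.FrobeniusLadderFInjectiveMacaulayficationFCentreE1RungZero
import Summits.ResolutionOfSingularities.ResolutionOfSingularities.Theorems.FrobeniusLadderFInjectiveMacaulayficationFCentreE1ChartPresentation
import Summits.ResolutionOfSingularities.ResolutionOfSingularities.Theorems.FrobeniusLadderFInjectiveMacaulayficationBlowupFiModelOfCover
import Literature.AlgebraicGeometry.Resolution.FBlowupUnique
import Literature.AlgebraicGeometry.Resolution.BlowupsFlatBaseChange
import Literature.AlgebraicGeometry.Resolution.BlowupStalkCharts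
import Literature.AlgebraicGeometry.Resolution.BlowupsScaling
import Literature.AlgebraicGeometry.Resolution.BlowupsLocal
import Literature.AlgebraicGeometry.Resolution.AffineBlowupCartier
import Literature.AlgebraicGeometry.Resolution.GenericFibreResolutionDatum
import HarnessLib

/-!
# R17.11 TIER-1, PART 3: `LFBAdm 2 1 4` IS REFUTED MODULO LEMMA N — `(c4) ∧ (c5) ∧ LEMMA N ⇒ False`
# (crux `FInjectiveMacaulayfication` stmt-ResolutionOfSingularities-15315, chain w45a; res-L1-w45a-plan-1 RULING R17.11 (2) / FIRST OBJECT 05:18:55Z;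
# spec = res-L1-w45a-stub-1 `FCentreE1-PLUMBING-PLAN.md` (UPDATE 04:20Z) + res-L1-w45a-tri-2 REFEREE NOTE 04:09:04Z; seat res-L1-w45a-stub-2 g7)

[OURS · L1 W4.5a] Support file (`--supports stmt-ResolutionOfSingularities-15315 --as helper`); def-free; a NEGATIVE-MODULO-H result about the CANDIDATE
census statement `FCentreCandidate.LFBAdm` (a `@[conjecture] def` of OURS, not a route item); replaces the role of NO printed item; NOT a statement
of the manuscript; AI-written (AI review is weaker than expert review).

SETTING (`X 0 = x`, `X 1 = y`, `X 2 = u`, `X 3 = t`, `X 4 = z`): `f = z² + x⁴z + y³ + u³ + t³`, `char k = 2`, `X = Spec R̄`, `R̄ = k[X]/(f)`, `v` the origin,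
`A = 𝒪_{X,v}`, `𝔮̄ = (x̄², ȳ, ū, t̄, z̄) ⊆ R̄`.
* LEMMA N (res-L1-w45a-idea-1 FB5-r1 §4.4; the ONE unformalised input, carried as the binder `hN`): for every fraction field `K` of `A`, the first
  Frobenius norm ideal `[[F_* A]]` of `A` (Villamayor 2006 / Yasuda 2012, the tree's `IsFrobeniusNormIdeal K 2 1`) is `c · 𝔮̄⁴A` for some `c ≠ 0`.
* ★ `not_lFBAdm_two_one_four (hN) : ¬ FCentreCandidate.LFBAdm 2 1 4`. PROOF. `FCentreE1RungZero.lFBAdm_at_p2d4c` (p604287) instantiates `LFBAdm 2 1 4`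
  at the legal rung-0 input `(Spec A, 𝟙, ⊤)`: a centre `𝓚 ≠ ⊥` on `Spec A` with (c4) every blowing up along `𝓚` an `IsFBlowup 2 1` and (c5) every blowing up
  along `𝓚` FULL everywhere. Blow up: `π : S″ → Spec A` (`exists_isBlowup`). By (c4) and `IsFBlowup.isBlowup_of_isFrobeniusNormIdeal` (an F-blowup is a
  blowing up along EVERY norm representative; `U := ⊤`), with LEMMA N transported to `Γ(Spec A, ⊤)` (`isFrobeniusNormIdeal_map_of_ringEquiv`) and the
  principal factor `c` removed (`IsBlowup.of_span_singleton_mul`), `π` is a blowing up of `Spec A` along `(𝔮̄⁴A)~`. So is the flat base change to `Spec A`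
  of res-L1-w45a-stub-1's MODEL `affineBlowup I_A → Spec R̄`, `I_A = x̄⁶𝔮̄` (`affineBlowup_IA_isBlowup_q_pow`, p604690; `IsBlowup.pullback_snd_of_flat`,
  `comap_fromSpecStalk_eq_affineBlowupIdealSheaf`). By uniqueness of blowing ups the two are isomorphic over `Spec A`, so (c5) makes every stalk of the
  base-changed model FULL, hence (flat pro-open immersion: `isIso_stalkMap_of_flat_of_isPreimmersion`) the stalk of the model at every point over `v` —
  in particular at the origin of the `x̄⁸`-chart, whose local ring is `(k[x,T]/(F′))_{(x,T)}` by LEMMA E (`exists_chartPresentation`, p604690) and which is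
  NOT FULL by the parameter-ideal witness `FCentreE1ChartWitness.not_fullCl_chartOrigin` (p604021). Contradiction.
* §1 `isFrobeniusNormIdeal_map_of_ringEquiv` — Frobenius norm ideals transport along ring isomorphisms compatible with the maps to `K` (the norm SET only
  sees the image in `K`; the two spans have the same carrier).
* §2 `exists_chartOrigin_over_vertex` — the bad point of the model: a point of `affineBlowup I_A` over `v` whose stalk is not FULL.

HONEST STATUS: LEMMA N is NOT proved here (Tier 2, booked «FB5-r2-Lean»); the census label of `LFBAdm 2 1 4` becomes «R: kernel modulo LEMMA N».
For imperfect `k` with `[k : k²] = ∞` the binder is unsatisfiable (no finite `K²`-basis) — discharge it over a perfect field (e.g. `ZMod 2`).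
[folklore assembly, OURS as a certificate; cite: Villamayoru2006, Thm. 3.3 and 3.4; Yasuda2012, Def. 2.2 and Cor. 2.6; GortzWedhorn2020, Prop. 13.91;
StacksProject, Tag 0804, Tag 080A, Tag 01J7; Temkin2008, §2.1]
-/

-- single-problem summit: the doubled namespace component is forced
set_option linter.dupNamespace false

noncomputable section

open AlgebraicGeometry CategoryTheory CategoryTheory.Limits Literature.AlgebraicGeometry.Resolution TopologicalSpace IsLocalRing MvPolynomial

namespace Summit.ResolutionOfSingularities.ResolutionOfSingularities.Theorems.FInjectiveMacaulayfication.FCentreE1TierOne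

open Summit.ResolutionOfSingularities.ResolutionOfSingularities.Theorems.FInjectiveMacaulayfication
open SliceableCentre GermForm FCentreE1ChartWitness FCentreE1ChartPresentation FCentreE1RungZero

/-! ## §1 Frobenius norm ideals transport along ring isomorphisms over `K` -/

/-- **Frobenius norm ideals transport along isomorphisms over `K`.** If `σ : A ≃+* B` is compatible with the structure maps to the field `K`, then
`I ⊆ A` is a Frobenius norm ideal (at level `e`) iff `σ(I) ⊆ B` is: the norm set `{d | d^q = det_β(m), m ⊆ im(A → K)}` only depends on the common image,
and the `A`-span and the `B`-span of it have the same carrier. [folklore; cite: Villamayoru2006, §2 p. 123] -/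
theorem isFrobeniusNormIdeal_map_of_ringEquiv {K : Type} [Field K] {p : ℕ} [ExpChar K p] {e : ℕ}
    {A B : Type} [CommRing A] [CommRing B] [Algebra A K] [Algebra B K] (σ : A ≃+* B)
    (hσ : ∀ a : A, algebraMap B K (σ a) = algebraMap A K a) {I : Ideal A}
    (hI : IsFrobeniusNormIdeal K p e I) : IsFrobeniusNormIdeal K p e (I.map σ) := by
  classical
  obtain ⟨ι, hfin, hdec, β, hβ⟩ := hI
  refine ⟨ι, hfin, hdec, β, ?_⟩
  have hσ' : ∀ b : B, algebraMap A K (σ.symm b) = algebraMap B K b := fun b => by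
    rw [← hσ, RingEquiv.apply_symm_apply]
  -- the norm sets coincide
  have hset : frobeniusNormSet β B = frobeniusNormSet β A := by
    ext d
    simp only [mem_frobeniusNormSet_iff]
    constructor
    · rintro ⟨m, hm⟩
      refine ⟨fun i => σ.symm (m i), ?_⟩
      rw [hm]
      congr 2
      funext i
      exact (hσ' (m i)).symm
    · rintro ⟨m, hm⟩
      refine ⟨fun i => σ (m i), ?_⟩
      rw [hm]
      congr 2
      funext i
      exact (hσ (m i)).symm
  -- carriers: the image of `σ(I)` in `K` is the image of `I`
  ext d
  rw [IsLocalization.mem_coeSubmodule]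
  constructor
  · rintro ⟨b, hb, rfl⟩
    rw [Ideal.mem_map_iff_of_surjective σ σ.surjective] at hb
    obtain ⟨a, ha, rfl⟩ := hb
    change algebraMap B K (σ a) ∈ frobeniusNorm β B
    have hmem : algebraMap A K a ∈ frobeniusNorm β A := by
      rw [← hβ, IsLocalization.mem_coeSubmodule]; exact ⟨a, ha, rfl⟩
    rw [hσ a]
    -- `A`-span membership ⇒ `B`-span membership (same generating set, scalars through `σ`)
    refine Submodule.span_induction (p := fun x _ => x ∈ frobeniusNorm β B) ?_ ?_ ?_ ?_ hmem
    · intro x hx; exact Submodule.subset_span (by rwa [hset])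
    · exact Submodule.zero_mem _
    · intro x y _ _ hx hy; exact Submodule.add_mem _ hx hy
    · intro a x _ hx
      have : a • x = (σ a) • x := by
        rw [Algebra.smul_def, Algebra.smul_def, hσ a]
      rw [this]; exact Submodule.smul_mem _ _ hx
  · intro hd
    -- `B`-span membership ⇒ `A`-span membership ⇒ `d = algebraMap a`, `a ∈ I`
    have hmem : d ∈ frobeniusNorm β A := by
      refine Submodule.span_induction (p := fun x _ => x ∈ frobeniusNorm β A) ?_ ?_ ?_ ?_ hd
      · intro x hx; exact Submodule.subset_span (by rwa [← hset])
      · exact Submodule.zero_mem _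
      · intro x y _ _ hx hy; exact Submodule.add_mem _ hx hy
      · intro b x _ hx
        have : b • x = (σ.symm b) • x := by
          rw [Algebra.smul_def, Algebra.smul_def, hσ' b]
        rw [this]; exact Submodule.smul_mem _ _ hx
    rw [← hβ, IsLocalization.mem_coeSubmodule] at hmem
    obtain ⟨a, ha, rfl⟩ := hmem
    exact ⟨σ a, Ideal.mem_map_of_mem σ ha, hσ a⟩

/-! ## §2 The bad point of the model `affineBlowup I_A`: the origin of the `x̄⁸`-chart lies over the vertex and is NOT FULL -/

set_option maxHeartbeats 800000 in
-- the chart-ring types make elaboration of the presentation expensive (as in `FCentreE1ChartPresentation`)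
/-- **The bad point.** For `f`, `F′` as in LEMMA E and the vertex `v` of `X = Spec k[X]/(f)`: the model `affineBlowup I_A` has a point `y` with `π(y) = v`
whose local ring is NOT FULL — the origin of the `x̄⁸`-chart `Spec (R̄[I_A t])_{(x̄⁸t)} ≅ Spec k[x,T]/(F′)` (`exists_chartPresentation` ∘ `reesChartEquiv`),
pushed into the model by the open immersion `affineBlowup.chartι` (isomorphic stalks; `Spec.stalkIso`; `not_fullCl_chartOrigin`). It lies over `v`
because `φ(x̄ⱼ) = θ(Xⱼ)‾ ∈ (x, T)` for the chart structure map `φ` (`affineBlowup.chartι_π`). [OURS · certificate; cite: StacksProject, Tag 0804] -/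
theorem exists_chartOrigin_over_vertex (k : Type) [Field k] [CharP k 2] (f F' : MvPolynomial (Fin 5) k)
    (hf : f = X 4 ^ 2 + X 0 ^ 4 * X 4 + X 1 ^ 3 + X 2 ^ 3 + X 3 ^ 3)
    (hF : F' = X 4 ^ 2 + X 0 ^ 2 * X 4 + X 0 ^ 2 * (X 1 ^ 3 + X 2 ^ 3 + X 3 ^ 3))
    (v : Spec (.of (MvPolynomial (Fin 5) k ⧸ Ideal.span {f})))
    (hv : v.asIdeal = Ideal.span (Set.range fun j : Fin 5 => Ideal.Quotient.mk (Ideal.span {f}) (X j)))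
    (IA : Ideal (MvPolynomial (Fin 5) k ⧸ Ideal.span {f}))
    (hIA : IA = Ideal.span ((fun e : Fin 5 →₀ ℕ => Ideal.Quotient.mk (Ideal.span {f}) (monomial e (1 : k))) ''
        ((([![8, 0, 0, 0, 0], ![9, 0, 0, 0, 0], ![6, 1, 0, 0, 0], ![6, 0, 1, 0, 0], ![6, 0, 0, 1, 0], ![6, 0, 0, 0, 1]] : List (Fin 5 → ℕ)).map
          fun u => (Finsupp.equivFunOnFinite.symm u : Fin 5 →₀ ℕ)).toFinset : Set _))) :
    ∃ y : ↥(affineBlowup IA), (affineBlowup.π IA) y = v ∧ ¬ FullCl 2 ((affineBlowup IA).presheaf.stalk y) := by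
  classical
  set R := MvPolynomial (Fin 5) k ⧸ Ideal.span {f} with hR
  set mkf : MvPolynomial (Fin 5) k →+* R := Ideal.Quotient.mk (Ideal.span {f}) with hmkf
  subst hIA
  set a : R := mkf (monomial (Finsupp.equivFunOnFinite.symm ![8, 0, 0, 0, 0]) (1 : k)) with ha_def
  set IA : Ideal R := Ideal.span ((fun e : Fin 5 →₀ ℕ => mkf (monomial e (1 : k))) ''
        ((([![8, 0, 0, 0, 0], ![9, 0, 0, 0, 0], ![6, 1, 0, 0, 0], ![6, 0, 1, 0, 0], ![6, 0, 0, 1, 0], ![6, 0, 0, 0, 1]] : List (Fin 5 → ℕ)).map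
          fun u => (Finsupp.equivFunOnFinite.symm u : Fin 5 →₀ ℕ)).toFinset : Set _)) with hIA'
  have ha : a ∈ IA := Ideal.subset_span ⟨Finsupp.equivFunOnFinite.symm ![8, 0, 0, 0, 0], by simp, rfl⟩
  -- the chart ring `C = (R̄[I_A t])_{(x̄⁸ t)}` and its presentation `E : k[X]/(F′) ≃ C`
  set B := MvPolynomial (Fin 5) k ⧸ Ideal.span {F'} with hB
  set mkF : MvPolynomial (Fin 5) k →+* B := Ideal.Quotient.mk (Ideal.span {F'}) with hmkF
  obtain ⟨e, hbij, he⟩ := exists_chartPresentation k f F' hf hF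
  let E₁ : B ≃+* ↥(blowupAlgebra IA a) := RingEquiv.ofBijective e hbij
  let E : B ≃+* HomogeneousLocalization.Away (reesGrading IA) (reesT a ha) := E₁.trans (reesChartEquiv a ha).symm
  let θ : Fin 5 → MvPolynomial (Fin 5) k := fun j => if j = 0 then (X 0 : MvPolynomial (Fin 5) k) else X 0 ^ 2 * X j
  have hE : ∀ q : MvPolynomial (Fin 5) k, E (mkF (aeval θ q)) = reesChartBase a ha (mkf q) := by
    intro q
    apply (reesChartEquiv a ha).injective
    change reesChartEquiv a ha ((reesChartEquiv a ha).symm (e (mkF (aeval θ q)))) = _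
    rw [RingEquiv.apply_symm_apply, reesChartEquiv_reesChartBase]
    exact Subtype.ext (he q)
  -- the chart origin `P′` and its transport `q` to `C`
  set P' : Ideal B := Ideal.span (Set.range fun j : Fin 5 => mkF (X j)) with hP'
  haveI hP'max : P'.IsMaximal := isMaximal_chartOrigin k F' hF
  haveI : P'.IsPrime := hP'max.isPrime
  set q : Ideal (HomogeneousLocalization.Away (reesGrading IA) (reesT a ha)) := P'.comap E.symm.toRingHom with hq
  haveI hqp : q.IsPrime := Ideal.comap_isPrime _ _
  have hmem : ∀ c, c ∈ q ↔ E.symm c ∈ P' := fun c => Ideal.mem_comap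
  let y₀ : Spec (.of (HomogeneousLocalization.Away (reesGrading IA) (reesT a ha))) := ⟨q, hqp⟩
  refine ⟨affineBlowup.chartι a ha y₀, ?_, ?_⟩
  · -- over the vertex
    rw [← Scheme.Hom.comp_apply, affineBlowup.chartι_π, Spec.map_apply]
    apply PrimeSpectrum.ext
    rw [hv]
    have hmax : (Ideal.span (Set.range fun j : Fin 5 => mkf (X j))).IsMaximal :=
      DoublePointFermatCubicGerm.isMaximal_origin k f (constantCoeff_f k f hf)
    symm
    refine hmax.eq_of_le (Ideal.IsPrime.ne_top inferInstance) ?_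
    rw [Ideal.span_le]
    rintro _ ⟨j, rfl⟩
    change reesChartBase a ha (mkf (X j)) ∈ q
    rw [hmem, ← hE (X j), RingEquiv.symm_apply_apply]
    have h0 : mkF (X 0) ∈ P' := Ideal.subset_span ⟨0, rfl⟩
    by_cases hj : j = 0
    · subst hj
      simpa [θ] using h0
    · have : aeval θ (X j : MvPolynomial (Fin 5) k) = X 0 ^ 2 * X j := by simp [θ, hj]
      rw [this, map_mul, map_pow]
      exact Ideal.mul_mem_right _ _ (Ideal.pow_mem_of_mem _ h0 2 (by norm_num))
  · -- not FULL
    intro hfull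
    have h1 : FullCl 2 ((Spec (.of (HomogeneousLocalization.Away (reesGrading IA) (reesT a ha)))).presheaf.stalk y₀) :=
      FTemkinClosedPoints.fullCl_of_isIso_stalkMap' 2 (affineBlowup.chartι a ha) y₀ hfull
    have h2 : FullCl 2 (Localization.AtPrime q) :=
      WFixAtNonClosedDimTwo.fullCl_of_ringEquiv 2 (Spec.stalkIso (.of _) y₀).commRingCatIsoToRingEquiv h1
    obtain ⟨eQ⟩ := BlowupFiModelOfCover.nonempty_ringEquiv_localization_of_ringEquiv E P' q
      (fun x => by rw [hmem, RingEquiv.symm_apply_apply])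
    exact not_fullCl_chartOrigin k F' hF P' rfl (WFixAtNonClosedDimTwo.fullCl_of_ringEquiv 2 eQ.symm h2)


/-! ## §3 An F-blowup of `Spec 𝒪_{X,v}` with norm ideal `c · Q𝒪_{X,v}` is, locally on the source, the base change of any model of `Bl_Q` -/

/-- Ideal sheaves of ideals pull back along `Spec` of a morphism of `CommRingCat` (bundled form of `affineBlowup.comap_idealSheaf_specMap`). [folklore] -/
theorem comap_idealSheaf_specMap' {A B : CommRingCat.{0}} (g : A ⟶ B) (I : Ideal A) :
    (affineBlowup.idealSheaf I).comap (Spec.map g) = affineBlowup.idealSheaf (I.map g.hom) :=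
  affineBlowup.comap_idealSheaf_specMap g.hom I

set_option maxHeartbeats 800000 in
-- several scheme-level isomorphism transports
/-- **F-blowup + norm representative `c · Q𝒪_v` ⇒ the base change of a model of `Bl_Q` embeds openly into it.** `R` a domain, `v ∈ Spec R`, `Q ⊆ R`
nonzero, `πB : B → Spec R` a blowing up along `Q~` (the MODEL), `π : S″ → Spec 𝒪_v` an `e`-th F-blowup, and `c · Q𝒪_v` (`c ≠ 0`) a Frobenius norm ideal
of `𝒪_v` in the function field: then there is an OPEN IMMERSION `B ×_{Spec R} Spec 𝒪_v ⟶ S″` (indeed an isomorphism onto `π⁻¹(⊤)`). Steps: the norm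
ideal is moved to `Γ(Spec 𝒪_v, ⊤)` (§1), `IsFBlowup.isBlowup_of_isFrobeniusNormIdeal (U := ⊤)`, the factor `c` is dropped (`IsBlowup.of_span_singleton_mul`),
the base `Spec Γ(Spec 𝒪_v, ⊤)` is identified with `Spec 𝒪_v` (`IsBlowup.comp_iso`, `Scheme.isoSpec`, `IsAffineOpen.fromSpec_top`), the model is
base-changed flat along `fromSpecStalk` (`IsBlowup.pullback_snd_of_flat`, `comap_fromSpecStalk_eq_affineBlowupIdealSheaf`), and `IsBlowup.unique`.
[folklore assembly; cite: Villamayoru2006, Thm. 3.3 and 3.4; GortzWedhorn2020, Prop. 13.91 (2)] -/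
theorem exists_openImmersion_pullback_model_of_isFBlowup {p e : ℕ} {R : Type} [CommRing R] [IsDomain R]
    (v : Spec (.of R)) (Q : Ideal R) (hQ : Q ≠ ⊥)
    {B : Scheme.{0}} {πB : B ⟶ Spec (.of R)} (hmodel : IsBlowup πB (affineBlowup.idealSheaf Q))
    {S'' : Scheme.{0}} {π : S'' ⟶ Spec ((Spec (.of R)).presheaf.stalk v)}
    [IsIntegral (Spec ((Spec (.of R)).presheaf.stalk v))] [ExpChar (Spec ((Spec (.of R)).presheaf.stalk v)).functionField p]
    (hF : IsFBlowup p e π) (c : (Spec (.of R)).presheaf.stalk v) (hc : c ≠ 0)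
    (hcN : IsFrobeniusNormIdeal (Spec ((Spec (.of R)).presheaf.stalk v)).functionField p e
      (Ideal.span {c} * Q.map (((Spec (.of R)).presheaf.germ ⊤ v trivial).hom.comp (Scheme.ΓSpecIso (.of R)).inv.hom))) :
    ∃ g : pullback πB ((Spec (.of R)).fromSpecStalk v) ⟶ S'', IsOpenImmersion g := by
  classical
  -- notation: `A = 𝒪_{X,v}`, `φ : R → A`, `J₀ = Q·A`
  set φ : R →+* (Spec (.of R)).presheaf.stalk v :=
    ((Spec (.of R)).presheaf.germ ⊤ v trivial).hom.comp (Scheme.ΓSpecIso (.of R)).inv.hom with hφ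
  set J₀ : Ideal ((Spec (.of R)).presheaf.stalk v) := Q.map φ with hJ₀
  -- `J₀ ≠ ⊥`
  have hφinj : Function.Injective φ :=
    (germ_injective_of_isIntegral (X := Spec (.of R)) (U := ⊤) v trivial).comp
      (Scheme.ΓSpecIso (.of R)).commRingCatIsoToRingEquiv.symm.injective
  have hJ₀ : J₀ ≠ ⊥ := by
    rw [hJ₀, Ne, Ideal.map_eq_bot_iff_of_injective hφinj]; exact hQ
  -- the affine open `⊤` of `Spec A` and the transport `σ : A ≃ Γ(Spec A, ⊤)` of the norm ideal (§1)
  let U : (Spec ((Spec (.of R)).presheaf.stalk v)).affineOpens := ⟨⊤, isAffineOpen_top _⟩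
  haveI : Nonempty (U : (Spec ((Spec (.of R)).presheaf.stalk v)).Opens) := ⟨⟨closedPoint _, trivial⟩⟩
  haveI : IsDomain Γ(Spec ((Spec (.of R)).presheaf.stalk v), (U : (Spec ((Spec (.of R)).presheaf.stalk v)).Opens)) :=
    IsIntegral.component_integral _
  let σ : (Spec (.of R)).presheaf.stalk v ≃+* Γ(Spec ((Spec (.of R)).presheaf.stalk v), (U : (Spec ((Spec (.of R)).presheaf.stalk v)).Opens)) :=
    (Scheme.ΓSpecIso ((Spec (.of R)).presheaf.stalk v)).commRingCatIsoToRingEquiv.symm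
  have hστ : ∀ a, (Scheme.ΓSpecIso ((Spec (.of R)).presheaf.stalk v)).hom.hom (σ a) = a := fun a =>
    (Scheme.ΓSpecIso ((Spec (.of R)).presheaf.stalk v)).commRingCatIsoToRingEquiv.apply_symm_apply a
  have hσ : ∀ a, algebraMap Γ(Spec ((Spec (.of R)).presheaf.stalk v), (U : (Spec ((Spec (.of R)).presheaf.stalk v)).Opens))
      (Spec ((Spec (.of R)).presheaf.stalk v)).functionField (σ a) =
      algebraMap ((Spec (.of R)).presheaf.stalk v) (Spec ((Spec (.of R)).presheaf.stalk v)).functionField a :=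
    fun a => rfl
  have hN' : IsFrobeniusNormIdeal (Spec ((Spec (.of R)).presheaf.stalk v)).functionField p e (Ideal.span {σ c} * J₀.map σ) := by
    have h := isFrobeniusNormIdeal_map_of_ringEquiv σ hσ hcN
    rwa [Ideal.map_mul, Ideal.map_span, Set.image_singleton] at h
  -- the F-blowup is a blowing up along `(σc · J₀σ)~`, hence along `(J₀σ)~`
  have hb1 := hF.isBlowup_of_isFrobeniusNormIdeal U hN'
  have hJσ : J₀.map σ ≠ ⊥ := by
    rw [Ne, Ideal.map_eq_bot_iff_of_injective σ.injective]; exact hJ₀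
  have hσc : σ c ≠ 0 := (EmbeddingLike.map_ne_zero_iff).mpr hc
  have hb2 : IsBlowup (π ∣_ (U : (Spec ((Spec (.of R)).presheaf.stalk v)).Opens) ≫ U.2.isoSpec.hom) (affineBlowup.idealSheaf (J₀.map σ)) :=
    IsBlowup.of_span_singleton_mul (R := Γ(Spec ((Spec (.of R)).presheaf.stalk v), (U : (Spec ((Spec (.of R)).presheaf.stalk v)).Opens)))
      hJσ hσc hb1
  -- move the base `Spec Γ(Spec A, ⊤)` to `Spec A`
  have hb3 := hb2.comp_iso (Spec ((Spec (.of R)).presheaf.stalk v)).isoSpec.symm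
  have hmor : (π ∣_ (U : (Spec ((Spec (.of R)).presheaf.stalk v)).Opens) ≫ U.2.isoSpec.hom) ≫
      (Spec ((Spec (.of R)).presheaf.stalk v)).isoSpec.symm.hom = (π ⁻¹ᵁ (U : (Spec ((Spec (.of R)).presheaf.stalk v)).Opens)).ι ≫ π := by
    have h1 : (Spec ((Spec (.of R)).presheaf.stalk v)).isoSpec.inv = U.2.fromSpec := (IsAffineOpen.fromSpec_top (X := Spec _)).symm
    rw [Iso.symm_hom, h1, Category.assoc, IsAffineOpen.isoSpec_hom_fromSpec, morphismRestrict_ι]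
  rw [hmor] at hb3
  have hJback : (J₀.map σ).map (Scheme.ΓSpecIso ((Spec (.of R)).presheaf.stalk v)).hom.hom = J₀ := by
    apply le_antisymm
    · rw [Ideal.map_le_iff_le_comap, Ideal.map_le_iff_le_comap]
      intro a ha
      rw [Ideal.mem_comap, Ideal.mem_comap, hστ a]
      exact ha
    · intro a ha
      have := Ideal.mem_map_of_mem (Scheme.ΓSpecIso ((Spec (.of R)).presheaf.stalk v)).hom.hom (Ideal.mem_map_of_mem σ ha)
      rwa [hστ a] at this
  have hidl : (affineBlowup.idealSheaf (J₀.map σ)).comap (Spec ((Spec (.of R)).presheaf.stalk v)).isoSpec.symm.inv =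
      affineBlowup.idealSheaf J₀ := by
    rw [Iso.symm_inv, Scheme.isoSpec_Spec_hom, comap_idealSheaf_specMap', hJback]
  have hb4 : IsBlowup ((π ⁻¹ᵁ (U : (Spec ((Spec (.of R)).presheaf.stalk v)).Opens)).ι ≫ π) (affineBlowup.idealSheaf J₀) :=
    (congrArg (IsBlowup ((π ⁻¹ᵁ (U : (Spec ((Spec (.of R)).presheaf.stalk v)).Opens)).ι ≫ π)) hidl).mp hb3
  -- the model, base-changed flat to `Spec A`, is a blowing up along `J₀~` too
  haveI : Flat ((Spec (.of R)).fromSpecStalk v) := flat_fromSpecStalk _ v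
  have hP := hmodel.pullback_snd_of_flat ((Spec (.of R)).fromSpecStalk v)
  have hst : stalkIdeal (affineBlowup.idealSheaf Q) v = J₀ := by
    rw [stalkIdeal_eq_map_germ _ ⟨⊤, isAffineOpen_top _⟩ trivial, affineBlowup.idealSheaf, ideal_ofIdealTop_top, Ideal.map_map]
  rw [comap_fromSpecStalk_eq_affineBlowupIdealSheaf, hst] at hP
  -- uniqueness of blowing ups
  obtain ⟨eP, -, -⟩ := hP.unique hb4
  exact ⟨eP.hom ≫ (π ⁻¹ᵁ (U : (Spec ((Spec (.of R)).presheaf.stalk v)).Opens)).ι, inferInstance⟩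

/-! ## §4 ★ `LFBAdm 2 1 4` refuted modulo LEMMA N -/

set_option maxHeartbeats 800000 in
-- instantiation + several transports
/-- ★ **R17.11 TIER 1: `¬ FCentreCandidate.LFBAdm 2 1 4` MODULO LEMMA N.** With `f = z² + x⁴z + y³ + u³ + t³` over a field `k` of characteristic 2, `v` the origin of
`X = Spec k[X]/(f)` and `A = 𝒪_{X,v}`: IF for every fraction field `K` of `A` the ideal `c · 𝔮̄⁴A` (`𝔮̄ = (x̄², ȳ, ū, t̄, z̄)`, some `c ≠ 0`) is a first Frobenius
norm ideal of `A` in `K` (LEMMA N, res-L1-w45a-idea-1 FB5-r1 §4.4 — NOT proved here), THEN the census candidate `LFBAdm 2 1 4` is false: its instantiation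
at the rung-0 input `(Spec A, 𝟙, ⊤)` (p604287) yields `𝓚` with (c4) ∧ (c5); by §3 the base change to `Spec A` of the model `affineBlowup I_A` (a blowing up
along `𝔮̄⁴`, p604690) embeds openly into a blowing up along `𝓚`, so by (c5) and the pro-open stalk isomorphisms every point of the model over `v` is FULL —
contradicting §2 (`not_fullCl_chartOrigin`, p604021). [OURS · negative-modulo-LEMMA-N certificate about a candidate statement; cite: Villamayoru2006, Thm. 3.3;
Yasuda2012, Cor. 2.6; GortzWedhorn2020, Prop. 13.91; Temkin2008, §2.1] -/
theorem not_lFBAdm_two_one_four (k : Type) [Field k] [CharP k 2] (f : MvPolynomial (Fin 5) k)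
    (hf : f = X 4 ^ 2 + X 0 ^ 4 * X 4 + X 1 ^ 3 + X 2 ^ 3 + X 3 ^ 3)
    (v : Spec (.of (MvPolynomial (Fin 5) k ⧸ Ideal.span {f})))
    (hv : v.asIdeal = Ideal.span (Set.range fun j : Fin 5 => Ideal.Quotient.mk (Ideal.span {f}) (X j)))
    (hN : ∀ (K : Type) [Field K] [Algebra ((Spec (.of (MvPolynomial (Fin 5) k ⧸ Ideal.span {f}))).presheaf.stalk v) K]
        [IsFractionRing ((Spec (.of (MvPolynomial (Fin 5) k ⧸ Ideal.span {f}))).presheaf.stalk v) K] [ExpChar K 2],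
        ∃ c : (Spec (.of (MvPolynomial (Fin 5) k ⧸ Ideal.span {f}))).presheaf.stalk v, c ≠ 0 ∧
          IsFrobeniusNormIdeal K 2 1 (Ideal.span {c} *
            (Ideal.span {Ideal.Quotient.mk (Ideal.span {f}) (X 0) ^ 2, Ideal.Quotient.mk (Ideal.span {f}) (X 1),
                Ideal.Quotient.mk (Ideal.span {f}) (X 2), Ideal.Quotient.mk (Ideal.span {f}) (X 3), Ideal.Quotient.mk (Ideal.span {f}) (X 4)} ^ 4).map
              ((((Spec (.of (MvPolynomial (Fin 5) k ⧸ Ideal.span {f}))).presheaf.germ ⊤ v trivial).hom.comp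
                (Scheme.ΓSpecIso (.of (MvPolynomial (Fin 5) k ⧸ Ideal.span {f}))).inv.hom)))) :
    ¬ FCentreCandidate.LFBAdm 2 1 4 := by
  classical
  intro hL
  haveI hfp : (Ideal.span {f}).IsPrime := (Ideal.span_singleton_prime (prime_f k f hf).ne_zero).mpr (prime_f k f hf)
  haveI : IsDomain (MvPolynomial (Fin 5) k ⧸ Ideal.span {f}) := Ideal.Quotient.isDomain _
  haveI hXint : IsIntegral (Spec (.of (MvPolynomial (Fin 5) k ⧸ Ideal.span {f}))) := isIntegral_p2d4c k f hf
  -- the rung-0 instantiation: `𝓚` with (c4) and (c5)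
  obtain ⟨𝓚, -, -, -, hc4, hc5⟩ := lFBAdm_at_p2d4c hL k f hf v hv
  -- instances on `S′ = Spec 𝒪_{X,v}`
  haveI hSint : IsIntegral (Spec ((Spec (.of (MvPolynomial (Fin 5) k ⧸ Ideal.span {f}))).presheaf.stalk v)) :=
    FCentreCandidate.isIntegral_of_isBlowup_stalk (X := Spec (.of (MvPolynomial (Fin 5) k ⧸ Ideal.span {f}))) v
      (top_ne_bot_idealSheafData_Spec_stalk v) (isBlowup_id_top _)
  haveI hSexp : ExpChar (Spec ((Spec (.of (MvPolynomial (Fin 5) k ⧸ Ideal.span {f}))).presheaf.stalk v)).functionField 2 :=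
    FCentreCandidate.expChar_functionField_of_isBlowup_stalk 2 Nat.prime_two (X := Spec (.of (MvPolynomial (Fin 5) k ⧸ Ideal.span {f})))
      (Spec.map (CommRingCat.ofHom (algebraMap k (MvPolynomial (Fin 5) k ⧸ Ideal.span {f})))) v
      (top_ne_bot_idealSheafData_Spec_stalk v) (isBlowup_id_top _)
  -- blow up along `𝓚`: an F-blowup (c4), FULL everywhere (c5)
  obtain ⟨S'', π, hπ⟩ := exists_isBlowup _ 𝓚
  have hF : IsFBlowup 2 1 π := hc4 S'' π hπ
  -- LEMMA N in the function field of `S′`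
  obtain ⟨c, hc0, hcN⟩ := hN (Spec ((Spec (.of (MvPolynomial (Fin 5) k ⧸ Ideal.span {f}))).presheaf.stalk v)).functionField
  -- the model `affineBlowup I_A → Spec R̄` is a blowing up along `𝔮̄⁴`
  have hmodel := affineBlowup_IA_isBlowup_q_pow k f hf
  have h𝔮 : Ideal.span {Ideal.Quotient.mk (Ideal.span {f}) (X 0) ^ 2, Ideal.Quotient.mk (Ideal.span {f}) (X 1),
      Ideal.Quotient.mk (Ideal.span {f}) (X 2), Ideal.Quotient.mk (Ideal.span {f}) (X 3), Ideal.Quotient.mk (Ideal.span {f}) (X 4)} ^ 4 ≠ ⊥ := by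
    intro hbot
    have hmem : Ideal.Quotient.mk (Ideal.span {f}) (X 1) ^ 4 ∈ Ideal.span {Ideal.Quotient.mk (Ideal.span {f}) (X 0) ^ 2,
        Ideal.Quotient.mk (Ideal.span {f}) (X 1), Ideal.Quotient.mk (Ideal.span {f}) (X 2), Ideal.Quotient.mk (Ideal.span {f}) (X 3),
        Ideal.Quotient.mk (Ideal.span {f}) (X 4)} ^ 4 :=
      Ideal.pow_mem_pow (Ideal.subset_span (by simp)) 4
    rw [hbot, Ideal.mem_bot] at hmem
    exact pow_ne_zero 4 (mk_X_ne_zero k f hf).2 hmem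
  -- §3: the base-changed model embeds openly into `S″`
  obtain ⟨g, hg⟩ := exists_openImmersion_pullback_model_of_isFBlowup v _ h𝔮 hmodel hF c hc0 hcN
  -- §2: the bad point of the model, lifted to the base change (pro-open: isomorphic stalks)
  obtain ⟨y, hyv, hybad⟩ := exists_chartOrigin_over_vertex k f (X 4 ^ 2 + X 0 ^ 2 * X 4 + X 0 ^ 2 * (X 1 ^ 3 + X 2 ^ 3 + X 3 ^ 3)) hf rfl v hv _ rfl
  obtain ⟨t, ht⟩ := mem_range_pullback_fst_fromSpecStalk_of_eq (affineBlowup.π _) v hyv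
  haveI : Flat ((Spec (.of (MvPolynomial (Fin 5) k ⧸ Ideal.span {f}))).fromSpecStalk v) := flat_fromSpecStalk _ v
  haveI := isIso_stalkMap_of_flat_of_isPreimmersion
    (pullback.fst (affineBlowup.π _) ((Spec (.of (MvPolynomial (Fin 5) k ⧸ Ideal.span {f}))).fromSpecStalk v)) t
  -- (c5) at the image of `t` in `S″`, transported back along the open immersion and down to the model
  have hfull_t := FTemkinClosedPoints.fullCl_of_isIso_stalkMap' 2 g t (hc5 S'' π hπ (g t))
  have hfull_y := FTemkinClosedPoints.fullCl_of_isIso_stalkMap 2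
    (pullback.fst (affineBlowup.π _) ((Spec (.of (MvPolynomial (Fin 5) k ⧸ Ideal.span {f}))).fromSpecStalk v)) t hfull_t
  rw [ht] at hfull_y
  exact hybad hfull_y

end Summit.ResolutionOfSingularities.ResolutionOfSingularities.Theorems.FInjectiveMacaulayfication.FCentreE1TierOne

end
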